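import Literature.Probability.LatticeModels.LatticeGreenRiemannSum
import HarnessLib

/-!
# `BlockModeCounting` (stmt-AtomisticToContinuum-13597), the `d = 3` Riemann-sum constant:
# `Σ_{q ≢ 0 mod K} ε(q)^{-1/2} ≤ 2 K³`  (decomp-a2c · hand-1 g9)

The mode-counting step of route `BECIntegerBlockRotor` (`BlockModeCounting`, support item 13597) needs
the boundedness of the punctured Riemann sum `K⁻³ Σ_{q ∈ (ℤ/K)³, q ≠ 0} ε(q)^{-1/2}`,
`ε(q) = Σ_j (1 − cos(2π q_j/K))` (Kennedy–Lieb–Shastry / Wojtkiewicz–Pusz–Stachura's `𝓘₃ ≈ 0.644`;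
any uniform constant serves).  We prove, for every `K ≥ 1` and with the block waves indexed by
`q : Fin 3 → Fin K` as in the tree's Parseval identity (`…Kinematics.parseval_blockWaves_trialState`):

* `sum_inv_eps_le` — `Σ_{q ≠ 0} 1/ε(q) ≤ (27/8) K³`: Jordan's inequality per coordinate on the centred
  representatives `m_j = valMinAbs (q_j mod K)`, `ε(q) ≥ (8/K²)‖m‖_∞²`, injectivity of `q ↦ m` into the
  punctured box `{0 < ‖m‖_∞ ≤ K/2} ⊆ ℤ³`, and the tree's shell count
  `Literature.Probability.LatticeModels.sum_box_inv_norm_sq_le` (`Σ_{0<‖m‖_∞≤R} ‖m‖_∞⁻² ≤ 54R` in `d = 3`)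
  — the `Fin`-indexed twin of `g3bd_sum_inv_dispersion_le` (crux `InsertionFieldDelocalisation`, whose
  module's import cone is unbuilt on the farm at the time of writing, hence re-derived here);
* `sum_inv_sqrt_eps_le` — `Σ_{q ≠ 0} ε(q)^{-1/2} ≤ 2 K³` by Cauchy–Schwarz (`#{q} ≤ K³`, `27/8 ≤ 4`).

Pure real analysis; no definitions, no `sorry`.  [cite: KLS1988PRL, after eq. (8)]
-/

noncomputable section

open scoped BigOperators
open Finset Literature.Probability.LatticeModels

namespace Summit.AtomisticToContinuum.BoseEinsteinCondensation.Theorems.BECIntegerBlockRotorBlockModeCounting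

/-- The centred representative `m = valMinAbs (a mod K) ∈ (-K/2, K/2]` of `a : Fin K` has the same
cosine: `cos (2π a/K) = cos (2π m/K)`. [folklore] -/
theorem cos_fin_eq_cos_valMinAbs {K : ℕ} (hK : 0 < K) (a : Fin K) :
    Real.cos (2 * Real.pi * ((a : ℕ) : ℝ) / (K : ℝ)) =
      Real.cos (2 * Real.pi / K * ((((a : ℕ) : ZMod K).valMinAbs : ℝ))) := by
  haveI : NeZero K := ⟨hK.ne'⟩
  have hKr : (K : ℝ) ≠ 0 := by exact_mod_cast hK.ne'
  set x : ZMod K := ((a : ℕ) : ZMod K) with hx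
  have hval : x.val = (a : ℕ) := by rw [hx, ZMod.val_natCast, Nat.mod_eq_of_lt a.isLt]
  have ha : ((a : ℕ) : ℝ) = (x.val : ℝ) := by rw [hval]
  rw [ha]
  have hv := ZMod.val_eq_ite_valMinAbs x
  split_ifs at hv with hc
  · have hv2 : (x.val : ℤ) = x.valMinAbs := by simpa using hv
    have hv' : (x.val : ℝ) = (x.valMinAbs : ℝ) := by exact_mod_cast hv2
    rw [hv']
    ring_nf
  · have hv' : (x.val : ℝ) = (x.valMinAbs : ℝ) + K := by exact_mod_cast hv
    rw [hv', show 2 * Real.pi * ((x.valMinAbs : ℝ) + K) / K =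
      2 * Real.pi / K * (x.valMinAbs : ℝ) + 2 * Real.pi by field_simp, Real.cos_add_two_pi]

/-- **Jordan's bound per coordinate**: `8 m² / K² ≤ 1 − cos (2π a/K)`, `m = valMinAbs (a mod K)`, since
`|2π m/K| ≤ π` and `cos x ≤ 1 − (2/π²) x²` there. [folklore] -/
theorem coord_bound {K : ℕ} (hK : 0 < K) (a : Fin K) :
    8 * ((((a : ℕ) : ZMod K).valMinAbs : ℝ)) ^ 2 / (K : ℝ) ^ 2 ≤
      1 - Real.cos (2 * Real.pi * ((a : ℕ) : ℝ) / (K : ℝ)) := by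
  haveI : NeZero K := ⟨hK.ne'⟩
  have hKr : (0 : ℝ) < K := by exact_mod_cast hK
  rw [cos_fin_eq_cos_valMinAbs hK]
  set m : ℤ := (((a : ℕ) : ZMod K)).valMinAbs with hm
  have hb := ZMod.valMinAbs_mem_Ioc (((a : ℕ) : ZMod K))
  have hlo : -(K : ℝ) < 2 * (m : ℝ) := by
    have h : (-(K : ℤ) : ℝ) < ((m * 2 : ℤ) : ℝ) := by exact_mod_cast hb.1
    push_cast at h
    linarith
  have hhi : 2 * (m : ℝ) ≤ K := by
    have h : ((m * 2 : ℤ) : ℝ) ≤ ((K : ℤ) : ℝ) := by exact_mod_cast hb.2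
    push_cast at h
    linarith
  have hθ : |2 * Real.pi / K * (m : ℝ)| ≤ Real.pi := by
    rw [abs_le]
    constructor
    · rw [div_mul_eq_mul_div, le_div_iff₀ hKr]
      nlinarith [Real.pi_pos]
    · rw [div_mul_eq_mul_div, div_le_iff₀ hKr]
      nlinarith [Real.pi_pos]
  have hj := Real.cos_le_one_sub_mul_cos_sq hθ
  have heq : 2 / Real.pi ^ 2 * (2 * Real.pi / K * (m : ℝ)) ^ 2 = 8 * (m : ℝ) ^ 2 / (K : ℝ) ^ 2 := by
    field_simp
    ring
  rw [← heq]
  linarith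

/-- **Termwise bound**: for `q ≠ 0`, `1/ε(q) ≤ (K²/8) ‖m(q)‖_∞⁻²` with `m(q)_j = valMinAbs (q_j mod K) ∈ ℤ³`,
and `ε(q) > 0`. [folklore] -/
theorem inv_eps_le {K : ℕ} (hK : 0 < K) {q : Fin 3 → Fin K} (hq : q ≠ fun _ => (⟨0, hK⟩ : Fin K)) :
    0 < ∑ j : Fin 3, (1 - Real.cos (2 * Real.pi * ((q j : ℕ) : ℝ) / (K : ℝ))) ∧
    1 / (∑ j : Fin 3, (1 - Real.cos (2 * Real.pi * ((q j : ℕ) : ℝ) / (K : ℝ)))) ≤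
      (K : ℝ) ^ 2 / 8 * (‖(fun j => (((q j : ℕ) : ZMod K)).valMinAbs : Site 3)‖ ^ 2)⁻¹ := by
  haveI : NeZero K := ⟨hK.ne'⟩
  have hKr : (0 : ℝ) < K := by exact_mod_cast hK
  set n : Site 3 := fun j => (((q j : ℕ) : ZMod K)).valMinAbs with hn
  -- `n ≠ 0`
  have hn0 : n ≠ 0 := by
    intro h
    apply hq
    funext j
    have hj : n j = 0 := by rw [h]; rfl
    have hz : (((q j : ℕ) : ZMod K)) = 0 := (ZMod.valMinAbs_eq_zero _).1 hj
    have hdvd : K ∣ (q j : ℕ) := (ZMod.natCast_eq_zero_iff _ _).1 hz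
    have h0 : (q j : ℕ) = 0 := Nat.eq_zero_of_dvd_of_lt hdvd (q j).isLt
    exact Fin.ext h0
  have hnpos : 0 < ‖n‖ ^ 2 := by
    have := norm_pos_iff.2 hn0
    positivity
  -- `‖n‖_∞² ≤ Σ_j n_j²`
  have hnorm : ‖n‖ ^ 2 ≤ ∑ j, ((n j : ℤ) : ℝ) ^ 2 := by
    obtain ⟨i, hi⟩ := Site.exists_natAbs_eq_supNorm Finset.univ_nonempty n
    have hni : ‖n‖ ^ 2 = ((n i : ℤ) : ℝ) ^ 2 := by
      rw [Site.norm_eq_supNorm, ← hi, Nat.cast_natAbs, Int.cast_abs, sq_abs]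
    rw [hni]
    exact Finset.single_le_sum (f := fun j => ((n j : ℤ) : ℝ) ^ 2) (fun j _ => sq_nonneg _)
      (Finset.mem_univ i)
  -- `(8/K²) ‖n‖² ≤ ε(q)`
  have hε : 8 / (K : ℝ) ^ 2 * ‖n‖ ^ 2 ≤
      ∑ j : Fin 3, (1 - Real.cos (2 * Real.pi * ((q j : ℕ) : ℝ) / (K : ℝ))) :=
    calc 8 / (K : ℝ) ^ 2 * ‖n‖ ^ 2 ≤ 8 / (K : ℝ) ^ 2 * ∑ j, ((n j : ℤ) : ℝ) ^ 2 := by gcongr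
      _ = ∑ j, 8 * ((((q j : ℕ) : ZMod K).valMinAbs : ℤ) : ℝ) ^ 2 / (K : ℝ) ^ 2 := by
          rw [Finset.mul_sum]
          refine Finset.sum_congr rfl fun j _ => ?_
          rw [hn]
          ring
      _ ≤ ∑ j : Fin 3, (1 - Real.cos (2 * Real.pi * ((q j : ℕ) : ℝ) / (K : ℝ))) :=
          Finset.sum_le_sum fun j _ => coord_bound hK (q j)
  have hpos : 0 < 8 / (K : ℝ) ^ 2 * ‖n‖ ^ 2 := by positivity
  refine ⟨hpos.trans_le hε, ?_⟩
  calc 1 / (∑ j : Fin 3, (1 - Real.cos (2 * Real.pi * ((q j : ℕ) : ℝ) / (K : ℝ))))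
      ≤ 1 / (8 / (K : ℝ) ^ 2 * ‖n‖ ^ 2) := one_div_le_one_div_of_le hpos hε
    _ = (K : ℝ) ^ 2 / 8 * (‖n‖ ^ 2)⁻¹ := by field_simp

/-- **The punctured momentum sum in `d = 3`**: `Σ_{q ≠ 0} 1/ε(q) ≤ (27/8) K³` for the block-wave
dispersion `ε(q) = Σ_j (1 − cos(2π q_j/K))`, `q : Fin 3 → Fin K` (termwise Jordan bound, injectivity of the
centred representatives into the punctured box of radius `K/2`, and the tree's shell count
`sum_box_inv_norm_sq_le`: `Σ_{0<‖m‖_∞≤R} ‖m‖_∞⁻² ≤ 54 R`). [cite: KLS1988PRL, after eq. (8)] -/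
theorem sum_inv_eps_le {K : ℕ} (hK : 0 < K) :
    ∑ q ∈ (univ : Finset (Fin 3 → Fin K)).erase (fun _ => (⟨0, hK⟩ : Fin K)),
      1 / (∑ j : Fin 3, (1 - Real.cos (2 * Real.pi * ((q j : ℕ) : ℝ) / (K : ℝ)))) ≤
      27 / 8 * (K : ℝ) ^ 3 := by
  haveI : NeZero K := ⟨hK.ne'⟩
  have hKr : (0 : ℝ) < K := by exact_mod_cast hK
  set m : (Fin 3 → Fin K) → Site 3 := fun q j => (((q j : ℕ) : ZMod K)).valMinAbs with hm
  set s : Finset (Fin 3 → Fin K) := (univ : Finset (Fin 3 → Fin K)).erase (fun _ => (⟨0, hK⟩ : Fin K))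
    with hs
  have hinj : Set.InjOn m ↑s := by
    intro q _ q' _ hqq'
    funext j
    have h : m q j = m q' j := by rw [hqq']
    have h2 : (((q j : ℕ) : ZMod K)) = (((q' j : ℕ) : ZMod K)) := ZMod.injective_valMinAbs h
    have h3 : (q j : ℕ) % K = (q' j : ℕ) % K := (ZMod.natCast_eq_natCast_iff' _ _ _).1 h2
    rw [Nat.mod_eq_of_lt (q j).isLt, Nat.mod_eq_of_lt (q' j).isLt] at h3
    exact Fin.ext h3
  -- the image lies in the punctured box of radius `K/2`
  have hsub : s.image m ⊆ (box 3 (K / 2)).erase 0 := by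
    intro n hn
    rw [Finset.mem_image] at hn
    obtain ⟨q, hq, rfl⟩ := hn
    rw [hs, Finset.mem_erase] at hq
    rw [Finset.mem_erase]
    constructor
    · intro h
      apply hq.1
      funext j
      have hj : m q j = 0 := by rw [h]; rfl
      have hz : (((q j : ℕ) : ZMod K)) = 0 := (ZMod.valMinAbs_eq_zero _).1 hj
      have hdvd : K ∣ (q j : ℕ) := (ZMod.natCast_eq_zero_iff _ _).1 hz
      exact Fin.ext (Nat.eq_zero_of_dvd_of_lt hdvd (q j).isLt)
    · rw [mem_box]
      intro j
      have h := ZMod.natAbs_valMinAbs_le (((q j : ℕ) : ZMod K))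
      change -((K / 2 : ℕ) : ℤ) ≤ (((q j : ℕ) : ZMod K)).valMinAbs ∧
        (((q j : ℕ) : ZMod K)).valMinAbs ≤ ((K / 2 : ℕ) : ℤ)
      omega
  -- termwise bound, then reindex by the injective map `m`
  have h1 : ∑ q ∈ s, 1 / (∑ j : Fin 3, (1 - Real.cos (2 * Real.pi * ((q j : ℕ) : ℝ) / (K : ℝ)))) ≤
      ∑ q ∈ s, (K : ℝ) ^ 2 / 8 * (‖m q‖ ^ 2)⁻¹ := by
    refine Finset.sum_le_sum fun q hq => ?_
    rw [hs, Finset.mem_erase] at hq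
    exact (inv_eps_le hK hq.1).2
  have h2 : ∑ q ∈ s, (K : ℝ) ^ 2 / 8 * (‖m q‖ ^ 2)⁻¹ =
      (K : ℝ) ^ 2 / 8 * ∑ n ∈ s.image m, (‖n‖ ^ 2)⁻¹ := by
    rw [Finset.sum_image hinj, Finset.mul_sum]
  have h3 : ∑ n ∈ s.image m, (‖n‖ ^ 2)⁻¹ ≤ ∑ n ∈ (box 3 (K / 2)).erase 0, (‖n‖ ^ 2)⁻¹ :=
    Finset.sum_le_sum_of_subset_of_nonneg hsub fun n _ _ => by positivity
  have h4 : ∑ n ∈ (box 3 (K / 2)).erase 0, (‖n‖ ^ 2)⁻¹ ≤ 54 * ((K / 2 : ℕ) : ℝ) := by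
    have h := sum_box_inv_norm_sq_le (d := 3) le_rfl (K / 2)
    norm_num at h
    exact h
  have hR : ((K / 2 : ℕ) : ℝ) ≤ (K : ℝ) / 2 := Nat.cast_div_le
  calc ∑ q ∈ s, 1 / (∑ j : Fin 3, (1 - Real.cos (2 * Real.pi * ((q j : ℕ) : ℝ) / (K : ℝ))))
      ≤ (K : ℝ) ^ 2 / 8 * (54 * ((K : ℝ) / 2)) := by
        rw [h2] at h1
        refine h1.trans ?_
        gcongr
        exact h3.trans (h4.trans (by gcongr))
    _ = 27 / 8 * (K : ℝ) ^ 3 := by ring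

/-- **The Riemann-sum constant**: `Σ_{q ≠ 0} ε(q)^{-1/2} ≤ 2 K³` (Cauchy–Schwarz on `sum_inv_eps_le`, using
`#{q : Fin 3 → Fin K} = K³` and `27/8 ≤ 4`). [cite: KLS1988PRL, after eq. (8)] -/
theorem sum_inv_sqrt_eps_le {K : ℕ} (hK : 0 < K) :
    ∑ q ∈ (univ : Finset (Fin 3 → Fin K)).erase (fun _ => (⟨0, hK⟩ : Fin K)),
      1 / Real.sqrt (∑ j : Fin 3, (1 - Real.cos (2 * Real.pi * ((q j : ℕ) : ℝ) / (K : ℝ)))) ≤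
      2 * (K : ℝ) ^ 3 := by
  have hKr : (0 : ℝ) < K := by exact_mod_cast hK
  set s : Finset (Fin 3 → Fin K) := (univ : Finset (Fin 3 → Fin K)).erase (fun _ => (⟨0, hK⟩ : Fin K))
    with hs
  set g : (Fin 3 → Fin K) → ℝ := fun q =>
    1 / Real.sqrt (∑ j : Fin 3, (1 - Real.cos (2 * Real.pi * ((q j : ℕ) : ℝ) / (K : ℝ)))) with hg
  -- Cauchy–Schwarz with the constant function `1`
  have hCS := Finset.sum_mul_sq_le_sq_mul_sq s (fun _ => (1 : ℝ)) g
  have hone : ∑ q ∈ s, (1 : ℝ) ^ 2 ≤ (K : ℝ) ^ 3 := by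
    rw [Finset.sum_const, one_pow, nsmul_eq_mul, mul_one]
    have hc : (s.card : ℝ) ≤ ((Finset.univ : Finset (Fin 3 → Fin K)).card : ℝ) := by
      exact_mod_cast Finset.card_erase_le
    rw [Finset.card_univ, Fintype.card_fun, Fintype.card_fin, Fintype.card_fin] at hc
    push_cast at hc
    exact hc
  have hsq : ∑ q ∈ s, g q ^ 2 ≤ 27 / 8 * (K : ℝ) ^ 3 := by
    refine le_trans (Finset.sum_le_sum fun q hq => ?_) (sum_inv_eps_le hK)
    rw [hs, Finset.mem_erase] at hq
    have hε := (inv_eps_le hK hq.1).1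
    rw [hg]
    simp only
    rw [div_pow, one_pow, Real.sq_sqrt hε.le]
  have hsum0 : 0 ≤ ∑ q ∈ s, g q := Finset.sum_nonneg fun q _ => by rw [hg]; positivity
  have hmain : (∑ q ∈ s, g q) ^ 2 ≤ (2 * (K : ℝ) ^ 3) ^ 2 := by
    have h1 : (∑ q ∈ s, (fun _ => (1 : ℝ)) q * g q) = ∑ q ∈ s, g q :=
      Finset.sum_congr rfl fun q _ => one_mul _
    rw [h1] at hCS
    have hK3 : 0 ≤ (K : ℝ) ^ 3 := by positivity
    calc (∑ q ∈ s, g q) ^ 2 ≤ (∑ q ∈ s, (fun _ => (1 : ℝ)) q ^ 2) * ∑ q ∈ s, g q ^ 2 := hCS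
      _ ≤ (K : ℝ) ^ 3 * (27 / 8 * (K : ℝ) ^ 3) :=
          mul_le_mul hone hsq (Finset.sum_nonneg fun q _ => sq_nonneg _) hK3
      _ ≤ (2 * (K : ℝ) ^ 3) ^ 2 := by nlinarith [hK3]
  exact (pow_le_pow_iff_left₀ hsum0 (by positivity) two_ne_zero).1 hmain

end Summit.AtomisticToContinuum.BoseEinsteinCondensation.Theorems.BECIntegerBlockRotorBlockModeCounting

end
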